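import Summits.CriticalPhenomena.PercolationContinuityZ3.Theorems.PercNearOneGluingNoHeavyLowerTailSahiPair43CheckPacked

/-!
# Twisted three-partition positivity (★★) = (M⁺-3) on SIX letters: the PAIR-SATURATION CHECKER on the cube, PART 1 —
# tables, masks, the scalar profile and the scalar (exact) fall-back test

Support file (cell `prim-sahi`, seat `prim-sahi-typer` gen 34; `--supports stmt-CriticalPhenomena-4575`).  COMPUTABLE DEFINITIONS ONLY (no
theorems, no `sorry`); the soundness theorem ("`chunkCheck 6 M r = true` for all `r < M`" implies `threePartNT τ 𝒰 𝒱 𝒲 ≥ 0` for all twists and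
all up-sets of `2^(Fin 6)`, via `ThreePartition.threePartNT_nonneg_of_pairCondRel`) and the `native_decide` evaluations live in companion files.
Reference implementation and census: C program `c63b.c` of this seat (memo `FROM-prim-sahi-typer-gen34-PAIR-SATURATION-CUBE.md`).

ENCODING (parameter `m`, the number of coordinates; `m = 6` is the target).  A point of the cube `2^[m]` is a CODE `x < 2^m` (bit `i` = coordinate
`i`); `x ⊆ y` iff `x &&& y = x`.  A family of points is a MASK `F < 2^(2^m)` (bit `x` = point `x`).  An up-set `U` is represented by the mask of its
points; it is CO-GENERATED by the antichain of the maximal non-elements.  All tables are built once (`mkTabs m`) and threaded (`Tabs`).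

THE TEST (for a pair of up-set masks `(U,V)`, the down-set mask `D` of the free points, and a twist code `t`).  The PROFILE at the point `y` is
`c(y) = 2[y∈U∩V]·2^{|r|} + #{s ⊆ r : s⊕t ∈ U, (r∖s)⊕t ∈ V} − [y∈V]·#{s ⊆ r : s⊕t ∈ U} − [y∈U]·#{s ⊆ r : s⊕t ∈ V} − #{s ⊆ r : s⊕t ∈ U∩V}`,
`r = (y ⊕ t)ᶜ` (`= N_t(U,V,{y})`, the twisted three-partition functional with the singleton third slot — companion soundness file).  The pair passes at
`t` iff some DOWNWARD TRANSPORT (moving mass from `w` to `y ⊆ w`) makes `Σ_{y ∉ D} c(y) + Σ_{y ∈ D} min(c(y),0) ≥ 0` (the RELATIVE dual-cone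
criterion: every up-set whose maximal non-elements are free contains the complement of `D`).  PART 1 = the scalar version (profile as an `Array ℤ`,
exact plan by unit augmenting paths restricted to `D`, re-applied by the trusted `applyPlan`); PART 2 (`…CubeCheckPacked`) = the lane-vector version
over batches of pairs, the enumeration of the 2-coloured antichains and `chunkCheck`. [this work]
-/

namespace Summit.CriticalPhenomena.PercolationContinuityZ3.Theorems.ThreePartition.Cube

open SahiGridPattern.Pair43 (foldBelow allBelow countBelow)

/-! ### Codes and masks -/

/-- Number of coordinates of the point `x` among the first `m`. [this work] -/
def pc (m x : ℕ) : ℕ := countBelow m fun i => x.testBit i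

/-- `x ⊆ y` for codes. [this work] -/
def sub (x y : ℕ) : Bool := (x &&& y) == x

/-- The mask `Σ_{k<n, p k} 2^k`. [this work] -/
def maskOfN (n : ℕ) (p : ℕ → Bool) : ℕ := foldBelow n (fun k acc => if p k then acc ||| (1 <<< k) else acc) 0

/-- `16^k` (signature weight of a point with `k` coordinates). [this work] -/
def w16 (k : ℕ) : ℕ := 1 <<< (4 * k)

/-- `2^40`: separates the first-order and the second-order part of a coordinate key. [this work] -/
def C40 : ℕ := 1 <<< 40

/-- One step of the de Bruijn–Tengbergen–Kruyswijk symmetric chain decomposition: from the chains of `2^[n]` to those of `2^[n+1]`. [this work] -/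
def scdStep (n : ℕ) (chains : List (List ℕ)) : List (List ℕ) :=
  chains.flatMap fun ch =>
    let top := ch.getLastD 0
    if 2 ≤ ch.length then [ch ++ [top ||| (1 <<< n)], (ch.dropLast).map (· ||| (1 <<< n))] else [ch ++ [top ||| (1 <<< n)]]

/-- A symmetric chain decomposition of `2^[m]` (as lists of codes). [this work] -/
def scd (m : ℕ) : List (List ℕ) := foldBelow m (fun n chs => scdStep n chs) [[0]]

/-- All tables of the checker for `m` coordinates. [this work] -/
structure Tabs where
  /-- number of coordinates -/
  m : ℕ
  /-- number of points `2^m` -/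
  np : ℕ
  /-- mask of all points -/
  full : ℕ
  /-- `subT[a]` = mask of the points `⊆ a` -/
  subT : Array ℕ
  /-- `supT[a]` = mask of the points `⊇ a` -/
  supT : Array ℕ
  /-- `cmpT[a]` = mask of the points comparable with `a` -/
  cmpT : Array ℕ
  /-- `nextT[a]` = mask of the points with a larger code and incomparable with `a` -/
  nextT : Array ℕ
  /-- `noBit[i]` = mask of the points not containing coordinate `i` -/
  noBit : Array ℕ
  /-- chain index of every point in the symmetric chain decomposition -/
  chainId : Array ℕ
  /-- `subsL[r]` = the codes `⊆ r` -/
  subsL : Array (Array ℕ)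
  /-- `upL[y]` = the codes `⊋ y`, by increasing number of coordinates then increasing code -/
  upL : Array (Array ℕ)
  /-- all codes by decreasing number of coordinates then increasing code -/
  descOrd : Array ℕ
  /-- `pcT[x]` = number of coordinates of `x` -/
  pcT : Array ℕ

/-- Build the tables. [this work] -/
def mkTabs (m : ℕ) : Tabs :=
  let np := 1 <<< m
  let pcT : Array ℕ := Array.ofFn fun x : Fin np => pc m x
  let byRank : List ℕ := (List.range (m + 1)).flatMap fun k => (List.range np).filter fun x => pcT.getD x 0 == k
  let chs := scd m
  { m := m, np := np, full := (1 <<< np) - 1,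
    subT := Array.ofFn fun a : Fin np => maskOfN np fun b => sub b a,
    supT := Array.ofFn fun a : Fin np => maskOfN np fun b => sub a b,
    cmpT := Array.ofFn fun a : Fin np => maskOfN np fun b => sub b a || sub a b,
    nextT := Array.ofFn fun a : Fin np => maskOfN np fun b => decide (a.val < b) && !(sub b a) && !(sub a b),
    noBit := Array.ofFn fun i : Fin m => maskOfN np fun x => !(x.testBit i),
    chainId := Array.ofFn fun x : Fin np => foldBelow chs.length (fun c acc => if (chs.getD c []).contains x.val then c else acc) 0,
    subsL := Array.ofFn fun r : Fin np => ((List.range np).filter fun s => sub s r).toArray,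
    upL := Array.ofFn fun y : Fin np => (byRank.filter fun w => sub y w && !(w == y.val)).toArray,
    descOrd := ((List.range (m + 1)).reverse.flatMap fun k => (List.range np).filter fun x => pcT.getD x 0 == k).toArray,
    pcT := pcT }

/-- `T.subT[a] ||| …` over the codes of `pts`. [this work] -/
def orTab (A : Array ℕ) (pts : Array ℕ) : ℕ := pts.foldl (fun acc x => acc ||| A.getD x 0) 0

/-- `A[a] ||| …` over the points `a` of the mask `mask`. [this work] -/
def orBits (T : Tabs) (A : Array ℕ) (mask : ℕ) : ℕ := foldBelow T.np (fun a acc => if mask.testBit a then acc ||| A.getD a 0 else acc) 0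

/-- Points of the mask `U` having a lower cover in `U` (`x ∈ U` with `x ∖ {i} ∈ U` for some `i ∈ x`). [this work] -/
def upShift (T : Tabs) (U : ℕ) : ℕ := foldBelow T.m (fun i acc => acc ||| ((U &&& T.noBit.getD i 0) <<< (1 <<< i))) 0

/-- Minimal points of an up-set mask. [this work] -/
def minMask (T : Tabs) (U : ℕ) : ℕ := U ^^^ (U &&& upShift T U)

/-- Number of chains of the symmetric chain decomposition meeting the mask `free` (an upper bound for the width of `free`). [this work] -/
def chainBound (T : Tabs) (free : ℕ) : ℕ :=
  let ids := foldBelow T.np (fun a acc => if free.testBit a then acc ||| (1 <<< T.chainId.getD a 0) else acc) 0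
  pc T.np ids

/-! ### The scalar profile and the scalar fall-back test -/

/-- The profile of the pair of masks `(U,V)` at the twist code `t`, as an array over the point codes `y`. [this work] -/
def profileArr (T : Tabs) (U V t : ℕ) : Array ℤ :=
  let UV := U &&& V
  Array.ofFn fun y : Fin T.np =>
    let r := (T.np - 1) ^^^ (y.val ^^^ t)
    let L := T.subsL.getD r #[]
    let g : ℕ := L.foldl (fun acc s => if U.testBit (s ^^^ t) && V.testBit ((r ^^^ s) ^^^ t) then acc + 1 else acc) 0
    let fU : ℕ := L.foldl (fun acc s => if U.testBit (s ^^^ t) then acc + 1 else acc) 0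
    let fV : ℕ := L.foldl (fun acc s => if V.testBit (s ^^^ t) then acc + 1 else acc) 0
    let fUV : ℕ := L.foldl (fun acc s => if UV.testBit (s ^^^ t) then acc + 1 else acc) 0
    let top : ℕ := if UV.testBit y then 2 <<< T.pcT.getD r 0 else 0
    ((top + g : ℕ) : ℤ) - (((if V.testBit y then fU else 0) + (if U.testBit y then fV else 0) + fUV : ℕ) : ℤ)

/-- The relative criterion `Σ_{y ∉ D} c(y) + Σ_{y ∈ D} min(c(y),0) ≥ 0`. [this work] -/
def relCrit (T : Tabs) (c : Array ℤ) (D : ℕ) : Bool :=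
  decide (0 ≤ foldBelow T.np (fun y acc => acc + (if D.testBit y then min (c.getD y 0) 0 else c.getD y 0)) (0 : ℤ))

/-- One transfer of `amt` from `w` down to `y`; ignored unless `y ⊆ w` and both are codes. [this work] -/
def applyStep (T : Tabs) (c : Array ℤ) (w y amt : ℕ) : Array ℤ :=
  if sub y w && decide (w < T.np) && decide (y < T.np) then
    let c1 := c.setIfInBounds w (c.getD w 0 - amt)
    c1.setIfInBounds y (c1.getD y 0 + amt)
  else c

/-- Apply a transport plan (list of `(w, y, amount)`). [this work] -/
def applyPlan (T : Tabs) : Array ℤ → List (ℕ × ℕ × ℕ) → Array ℤ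
  | c, [] => c
  | c, (w, y, amt) :: rest => applyPlan T (applyStep T c w y amt) rest

/-- One augmenting path of the unit-step flow search inside `D`: from the supply point `w`, reach a demand point of `D` going down (`w → y`, `y ⊆ w`)
and back up along positive flow; returns the forward/backward steps and the visited supply points.  Fuel-bounded. [this work] -/
def augment (T : Tabs) (dem : Array ℤ) (f : Array (Array ℤ)) (D : ℕ) : ℕ → ℕ → Array Bool → Option (List (Bool × ℕ × ℕ)) × Array Bool
  | 0, _, vis => (none, vis)
  | fuel + 1, w, vis =>
    let vis := vis.setIfInBounds w true
    match (List.range T.np).find? (fun y => sub y w && D.testBit y && decide (0 < dem.getD y 0)) with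
    | some y => (some [(true, w, y)], vis)
    | none =>
      (List.range T.np).foldl (fun (acc : Option (List (Bool × ℕ × ℕ)) × Array Bool) y =>
          match acc.1 with
          | some _ => acc
          | none =>
            if sub y w && D.testBit y then
              (List.range T.np).foldl (fun (acc2 : Option (List (Bool × ℕ × ℕ)) × Array Bool) w' =>
                  match acc2.1 with
                  | some _ => acc2
                  | none =>
                    if !(acc2.2.getD w' false) && decide (0 < (f.getD w' #[]).getD y 0) then
                      match augment T dem f D fuel w' acc2.2 with
                      | (some path, vis2) => (some ((true, w, y) :: (false, w', y) :: path), vis2)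
                      | (none, vis2) => (none, vis2)
                    else acc2) acc
            else acc) (none, vis)

/-- Apply an augmenting path of one unit to the flow matrix. [this work] -/
def applyPath (f : Array (Array ℤ)) : List (Bool × ℕ × ℕ) → Array (Array ℤ)
  | [] => f
  | (fwd, w, y) :: rest =>
    let row := f.getD w #[]
    let row' := row.setIfInBounds y (row.getD y 0 + (if fwd then 1 else -1))
    applyPath (f.setIfInBounds w row') rest

/-- Unit augmentations until no augmenting path is left (fuel-bounded). [this work] -/
def flowLoop (T : Tabs) (D : ℕ) : ℕ → Array ℤ → Array ℤ → Array (Array ℤ) → Array (Array ℤ)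
  | 0, _, _, f => f
  | fuel + 1, sup, dem, f =>
    let r := (List.range T.np).foldl (fun (acc : Option (ℕ × List (Bool × ℕ × ℕ))) w =>
        match acc with
        | some _ => acc
        | none =>
          if D.testBit w && decide (0 < sup.getD w 0) then
            match (augment T dem f D T.np w (Array.replicate T.np false)).1 with
            | some path => some (w, path)
            | none => none
          else none) none
    match r with
    | none => f
    | some (w, path) =>
      let ylast := match path.getLast? with | some (_, _, y) => y | none => 0
      flowLoop T D fuel (sup.setIfInBounds w (sup.getD w 0 - 1)) (dem.setIfInBounds ylast (dem.getD ylast 0 - 1)) (applyPath f path)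

/-- The exact plan inside `D` (sources and sinks in `D`). [this work] -/
def flowPlan (T : Tabs) (c : Array ℤ) (D : ℕ) : List (ℕ × ℕ × ℕ) :=
  let sup := Array.ofFn fun k : Fin T.np => if D.testBit k.val then max (c.getD k 0) 0 else 0
  let dem := Array.ofFn fun k : Fin T.np => if D.testBit k.val then max (- c.getD k 0) 0 else 0
  let total := foldBelow T.np (fun k acc => acc + (dem.getD k 0).toNat) 0
  let f := flowLoop T D total sup dem (Array.replicate T.np (Array.replicate T.np (0 : ℤ)))
  (List.range T.np).flatMap fun w => (List.range T.np).filterMap fun y =>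
    let v := (f.getD w #[]).getD y 0
    if 0 < v then some (w, y, v.toNat) else none

/-- **The scalar test of one pair at one twist**: the profile, the exact plan, the relative criterion. [this work] -/
def scalarTest (T : Tabs) (U V D t : ℕ) : Bool :=
  let c := profileArr T U V t
  relCrit T c D || relCrit T (applyPlan T c (flowPlan T c D)) D

end Summit.CriticalPhenomena.PercolationContinuityZ3.Theorems.ThreePartition.Cube
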